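import Mathlib
import Summits.Ventures.HodgeRepro2.WeilIntegral
import Summits.Ventures.HodgeRepro2.A2IntegralDegree

/-!
# A2 annex — Poincaré duality in the twelve-plane model

In p5's model of `H^*(B, ℂ) = ⋀^* H¹(B, ℂ)` (`WeilPlanes` / `WeilIntegral`: `A ι = ⋀^* V ι`,
`V ι = (Gen ι → ℂ)`, `mono l` the wedge monomials, `integral` the model of `∫_B`), the pairing
`(x, u) ↦ ∫_B x ∧ u` is PERFECT: this file proves it and derives the model of the Gysin /
Poincaré-dual construction used throughout sub-claim A2 (route/T4-A2-p6.md v6, A2.0 (b), A4.1.0: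
`g_* = PD^{-1} ∘ g_*^{hom} ∘ PD`, and the existence of the class `y'` representing the functional
`u ↦ ∫_{B³} (f_*c₁ ⊗ f_*c₂ ⊗ θ⁴) ∪ m₃^* u` in Corollary A8.2).

* `aBasis`: the monomial basis of `A ι` (Mathlib's `Module.Basis.ExteriorAlgebra` on the standard
  basis of `V ι`, indexed by `Finset (Fin |Gen ι|)` through an enumeration of the generators);
  `aBasis_apply`: its vectors ARE p5's monomials `mono (genListOf s)`;
* `integral_aBasis_mul_aBasis_of_ne` / `integral_aBasis_mul_aBasis_compl`: the integral pairing of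
  two basis monomials is `0` unless the index sets are complementary, and `±1` when they are
  (p5's `integral_mono_eq_zero` / `integral_mono_of_forall_mem`); `integral_mul_aBasis_compl`:
  pairing with the complementary basis monomial reads off a coordinate (up to sign);
* **`eq_zero_of_forall_integral_mul_eq_zero`** (non-degeneracy: `∫_B x ∧ u = 0 ∀u ⇒ x = 0`),
  `integralPairing` (`x ↦ ∫_B x ∧ (·)` as a linear map to the dual), `integralPairing_injective`,
  **`integralPairing_bijective`** (finite dimension), **`integralDualEquiv`** (`A ι ≃ₗ Dual`),
  **`dualOf`** (the Poincaré dual of a functional: the unique `y` with `∫_B y ∧ u = P u` for all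
  `u`; `integral_dualOf_mul`, `dualOf_unique`, `dualOf_integralPairing`).

With `dualOf`, a Gysin push-forward `g_*` of the model is `dualOf (u ↦ ∫ (·) ∧ g^* u)` — the form
A4.1.0 gives it; the triple-sum class of Corollary A8.2 is `dualOf (pairThree …)` (next file).

Seat p6 (A2 owner), gen 16.  §8 (d): uses an L-value-free non-vanishing device: NO.
-/

namespace Summit.Ventures.HodgeRepro2.A2ModelDuality

open WeilPlanes WeilIntegral A2IntegralDegree

variable {ι : Type*} [DecidableEq ι] [Fintype ι]

/-- An enumeration of the generators `Gen ι = ι × Bool`. -/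
noncomputable def enum : Gen ι ≃ Fin (Fintype.card (Gen ι)) := Fintype.equivFin (Gen ι)

/-- The standard basis of `V ι = (Gen ι → ℂ)`, indexed by `Fin |Gen ι|` through `enum`. -/
noncomputable def vBasis : Module.Basis (Fin (Fintype.card (Gen ι))) ℂ (V ι) :=
  (Pi.basisFun ℂ (Gen ι)).reindex enum

/-- `vBasis k` is the standard basis vector of the generator `enum.symm k`. -/
theorem vBasis_apply (k : Fin (Fintype.card (Gen ι))) :
    (vBasis k : V ι) = Pi.single (enum.symm k) (1 : ℂ) := by
  simp [vBasis, Module.Basis.reindex_apply, Pi.basisFun_apply]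

/-- The generators of an index set `s`, listed in increasing order of their enumeration. -/
noncomputable def genListOf (s : Finset (Fin (Fintype.card (Gen ι)))) : List (Gen ι) :=
  List.ofFn fun i => (enum.symm (s.orderEmbOfFin rfl i) : Gen ι)

omit [DecidableEq ι] in
/-- `genListOf s` has no duplicates. -/
theorem nodup_genListOf (s : Finset (Fin (Fintype.card (Gen ι)))) : (genListOf s).Nodup :=
  List.nodup_ofFn.mpr (enum.symm.injective.comp (s.orderEmbOfFin rfl).injective)

omit [DecidableEq ι] in
/-- Membership in `genListOf s`. -/
theorem mem_genListOf (s : Finset (Fin (Fintype.card (Gen ι)))) (j : Gen ι) :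
    j ∈ genListOf s ↔ enum j ∈ s := by
  rw [genListOf, List.mem_ofFn]
  constructor
  · rintro ⟨i, hi⟩
    rw [← hi, Equiv.apply_symm_apply]
    exact Finset.orderEmbOfFin_mem s rfl i
  · intro hj
    have hmem : enum j ∈ Set.range (s.orderEmbOfFin rfl) := by
      rw [Finset.range_orderEmbOfFin]
      exact hj
    obtain ⟨i, hi⟩ := hmem
    exact ⟨i, by rw [hi, Equiv.symm_apply_apply]⟩

omit [DecidableEq ι] in
/-- `genListOf s` has length `|s|`. -/
theorem length_genListOf (s : Finset (Fin (Fintype.card (Gen ι)))) :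
    (genListOf s).length = s.card := by
  simp [genListOf]

/-- The monomial basis of `A ι = ⋀^* V ι`. -/
noncomputable def aBasis : Module.Basis (Finset (Fin (Fintype.card (Gen ι)))) ℂ (A ι) :=
  (vBasis (ι := ι)).ExteriorAlgebra

/-- The vectors of the monomial basis are p5's monomials. -/
theorem aBasis_apply (s : Finset (Fin (Fintype.card (Gen ι)))) :
    (aBasis s : A ι) = mono (genListOf s) := by
  rw [aBasis, ExteriorAlgebra.basis_apply_ofCard (s_card := rfl), ExteriorAlgebra.ιMulti_family,
    Set.powersetCard.ofFinEmbEquiv_symm_apply, genListOf, ← ιMulti_single_eq_mono]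
  congr 1
  funext i
  simp [vBasis_apply, Set.powersetCard.val_ofCard]

/-- Two basis monomials with non-complementary index sets pair to `0`. -/
theorem integral_aBasis_mul_aBasis_of_ne (s t : Finset (Fin (Fintype.card (Gen ι))))
    (hst : t ≠ sᶜ) : integral (aBasis s * aBasis t) = 0 := by
  rw [aBasis_apply, aBasis_apply, ← mono_append]
  apply integral_mono_eq_zero
  by_cases hnd : (genListOf s ++ genListOf t).Nodup
  · right
    by_contra hall
    simp only [not_exists, not_not] at hall
    apply hst
    have hdisj := (List.nodup_append.mp hnd).2.2
    ext k
    constructor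
    · intro hk
      rw [Finset.mem_compl]
      intro hks
      have h1 : enum.symm k ∈ genListOf s := (mem_genListOf s _).mpr (by simpa using hks)
      have h2 : enum.symm k ∈ genListOf t := (mem_genListOf t _).mpr (by simpa using hk)
      exact hdisj _ h1 _ h2 rfl
    · intro hk
      rw [Finset.mem_compl] at hk
      have := hall (enum.symm k)
      rw [List.mem_append, mem_genListOf, mem_genListOf, Equiv.apply_symm_apply] at this
      exact this.resolve_left hk
  · exact Or.inl hnd

/-- Two basis monomials with complementary index sets pair to `±1`. -/
theorem integral_aBasis_mul_aBasis_compl (s : Finset (Fin (Fintype.card (Gen ι)))) :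
    ∃ ε : ℂ, (ε = 1 ∨ ε = -1) ∧ integral (aBasis s * aBasis sᶜ) = ε := by
  rw [aBasis_apply, aBasis_apply, ← mono_append]
  apply integral_mono_of_forall_mem
  · refine List.nodup_append.mpr ⟨nodup_genListOf s, nodup_genListOf sᶜ, ?_⟩
    intro j hjs j' hjt hjj
    subst hjj
    rw [mem_genListOf] at hjs hjt
    exact (Finset.mem_compl.mp hjt) hjs
  · intro j
    rw [List.mem_append, mem_genListOf, mem_genListOf, Finset.mem_compl]
    exact em _

/-- The pairing of `x` with the complementary basis monomial reads off the `s`-coordinate of `x`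
(up to the sign `ε_s = ∫_B e_s ∧ e_{sᶜ} = ±1`). -/
theorem integral_mul_aBasis_compl (x : A ι) (s : Finset (Fin (Fintype.card (Gen ι)))) :
    ∃ ε : ℂ, (ε = 1 ∨ ε = -1) ∧ integral (x * aBasis sᶜ) = (aBasis (ι := ι)).repr x s * ε := by
  obtain ⟨ε, hε, hε'⟩ := integral_aBasis_mul_aBasis_compl s
  refine ⟨ε, hε, ?_⟩
  conv_lhs => rw [← (aBasis (ι := ι)).sum_repr x]
  rw [Finset.sum_mul, map_sum]
  simp only [smul_mul_assoc, map_smul]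
  rw [Finset.sum_eq_single s]
  · rw [hε', smul_eq_mul]
  · intro s' _ hs'
    rw [integral_aBasis_mul_aBasis_of_ne s' sᶜ (fun h => hs' (compl_injective h).symm), smul_zero]
  · intro hs
    exact absurd (Finset.mem_univ s) hs

/-- **Poincaré duality in the model (non-degeneracy).**  If `∫_B x ∧ u = 0` for every `u`, then
`x = 0`. -/
theorem eq_zero_of_forall_integral_mul_eq_zero {x : A ι} (h : ∀ u, integral (x * u) = 0) :
    x = 0 := by
  rw [(aBasis (ι := ι)).ext_elem_iff]
  intro s
  rw [map_zero, Finsupp.zero_apply]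
  obtain ⟨ε, hε, hε'⟩ := integral_mul_aBasis_compl x s
  rw [h, eq_comm, mul_eq_zero] at hε'
  refine hε'.resolve_right ?_
  rcases hε with rfl | rfl <;> norm_num

/-- The integral pairing `x ↦ ∫_B x ∧ (·)` as a linear map into the dual. -/
noncomputable def integralPairing : A ι →ₗ[ℂ] Module.Dual ℂ (A ι) :=
  (LinearMap.mul ℂ (A ι)).compr₂ integral

omit [DecidableEq ι] in
/-- Unfolding `integralPairing`. -/
@[simp] theorem integralPairing_apply (x u : A ι) : integralPairing x u = integral (x * u) := rfl

/-- The integral pairing is injective. -/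
theorem integralPairing_injective : Function.Injective (integralPairing (ι := ι)) := by
  rw [← LinearMap.ker_eq_bot, LinearMap.ker_eq_bot']
  intro x hx
  apply eq_zero_of_forall_integral_mul_eq_zero
  intro u
  rw [← integralPairing_apply, hx, LinearMap.zero_apply]

omit [DecidableEq ι] in
/-- `A ι` is finite-dimensional (it has the finite monomial basis). -/
theorem finiteDimensional_A : FiniteDimensional ℂ (A ι) := Module.Finite.of_basis aBasis

/-- The integral pairing is bijective: `A ι ≅ Dual(A ι)` (Poincaré duality in the model). -/
theorem integralPairing_bijective : Function.Bijective (integralPairing (ι := ι)) := by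
  haveI := finiteDimensional_A (ι := ι)
  exact ⟨integralPairing_injective,
    (LinearMap.injective_iff_surjective_of_finrank_eq_finrank
      (Subspace.dual_finrank_eq (V := A ι)).symm).mp integralPairing_injective⟩

/-- Poincaré duality in the model as a linear equivalence `A ι ≃ₗ[ℂ] Dual(A ι)`. -/
noncomputable def integralDualEquiv : A ι ≃ₗ[ℂ] Module.Dual ℂ (A ι) :=
  LinearEquiv.ofBijective integralPairing integralPairing_bijective

/-- The Poincaré dual of a functional `P`: the unique `y` with `∫_B y ∧ u = P u` for all `u`. -/
noncomputable def dualOf (P : Module.Dual ℂ (A ι)) : A ι := integralDualEquiv.symm P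

/-- `dualOf P` represents `P` against the integral. -/
theorem integral_dualOf_mul (P : Module.Dual ℂ (A ι)) (u : A ι) :
    integral (dualOf P * u) = P u := by
  have h : integralPairing (dualOf P) = P := by
    rw [dualOf, ← LinearEquiv.ofBijective_apply (f := integralPairing)
      (hf := integralPairing_bijective), ← integralDualEquiv, LinearEquiv.apply_symm_apply]
  rw [← integralPairing_apply, h]

/-- Uniqueness of the representing class. -/
theorem dualOf_unique (P : Module.Dual ℂ (A ι)) {y : A ι} (hy : ∀ u, integral (y * u) = P u) :
    y = dualOf P := by
  apply integralPairing_injective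
  refine LinearMap.ext fun u => ?_
  rw [integralPairing_apply, hy, ← integral_dualOf_mul P u, integralPairing_apply]

/-- `dualOf` inverts the pairing. -/
@[simp] theorem dualOf_integralPairing (x : A ι) : dualOf (integralPairing x) = x :=
  (dualOf_unique _ fun _ => rfl).symm

end Summit.Ventures.HodgeRepro2.A2ModelDuality
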